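import Literature.AlgebraicGeometry.Resolution.Kuhlmann2019Prop52FirstSteps
import Literature.AlgebraicGeometry.Resolution.Kuhlmann2019HenselianRationalityFiniteRank
import Literature.AlgebraicGeometry.Resolution.Kuhlmann2019Lemma54Proofs
import Literature.AlgebraicGeometry.Resolution.Kuhlmann2019HenselianRationalityLemmas
import Literature.AlgebraicGeometry.Resolution.NormalDegreePDefectless
import HarnessLib

/-!
# Kuhlmann 2019, Prop. 5.2 reduced to its degree-`p` step (Props. 4.8/4.9) and [23, Thm. 11.1]

Topic: `Literature/AlgebraicGeometry/Resolution` (valued function fields). Sequel of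
`Kuhlmann2019Prop52FirstSteps.lean` (Lemma 5.1 and the residue-characteristic-`0` case): the
**tower induction** in the printed proof of F.-V. Kuhlmann, *Elimination of ramification II:
Henselian rationality*, Israel J. Math. 234 (2019) = arXiv:1701.05508, **Prop. 5.2** (p. 12;
the named fact `Kuhlmann2019_Prop52_sepClosed` of `Kuhlmann2019HenselianRationalityFiniteRank.lean`,
a leaf of the decomposition of Knaf–Kuhlmann 2009, Thm. 1.1, `KnafKuhlmann2009Leaves.lean`):

> We choose a separating element `x` of `F`. Since the subextension `(K(x)|K,v)` of `(F|K,v)`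
> is immediate, we have that `vK(x) = vK` is divisible and `K(x)v = Kv` is algebraically
> closed. If `F ⊆ K(x)^h` does not already hold, then by Lemma 5.1 the nontrivial finite
> separable extension `F.K(x)^h|K(x)^h` is a tower of Galois extensions of degree `p`. By
> induction on the number of Galois extensions in the tower, using Proposition 4.8 or
> Proposition 4.9 respectively, we find `y ∈ F^h` such that `F.K(x)^h = K(y)^h` and therefore,
> `F ⊆ K(y)^h`. (Proposition 4.8 can be applied because every separable-algebraically closed
> valued field is separably tame, and Proposition 4.9 can be applied because every
> separable-algebraically closed field of characteristic 0 is algebraically closed.) Now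
> [23, Theorem 11.1] shows that `y` can already be chosen in `F`, which proves that `(F|K,v)`
> is henselian rational.

with

> **Proposition 4.8.** Take a separably tame valued field `(K,v)` of characteristic `p > 0` and
> rank 1, an immediate transcendental extension `(K(x)|K,v)`, and a Galois extension `E` of
> `K(x)^h` of degree `p`. Then there exists `ϑ ∈ E` such that `E = K(ϑ)^h`.
> **Proposition 4.9.** Take an algebraically closed valued field `(K,v)` of characteristic 0
> and rank 1, an immediate transcendental extension `(K(x)|K,v)`, and a Galois extension `E`
> of `K(x)^h` of degree `p = char Kv > 0`. Then there is some `η ∈ E` such that `E = K(η)^h`.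

This file PROVES that induction and the surrounding bookkeeping, so that
`Kuhlmann2019_Prop52_sepClosed` follows from exactly two statements, taken here as HYPOTHESES
spelled out in the ambient rendering (they are the remaining content of the printed proof — the
Artin–Schreier / Kummer normal forms of §§3–4 built on Kuhlmann–Vlahu [23], and [23, Thm. 11.1]
— and are NOT vendored as named facts by this file):

* `(hstep)` — **Props. 4.8 / 4.9 for a separable-algebraically closed `K` of rank one** (the
  two printed cases together: such a `K` is separably tame, and algebraically closed when
  `char K = 0`): for `y` transcendental over `K` with `(K(y)|K, V)` immediate and a Galois
  extension `E` of degree `p = char (Ωv) > 0` of `K(y)^h = henselization V K(y)` inside `Ω`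
  (`IsGaloisStep p`), there is `ϑ ∈ E` with `E = K(ϑ)^h`;
* `(hKV)` — **[23, Thm. 11.1] as applied** (F.-V. Kuhlmann, I. Vlahu, *The relative
  approximation degree in valued function fields*, Math. Z. 276 (2014) 203–235, Thm. 11.1:
  "`y` can already be chosen in `F`"): under the hypotheses of Prop. 5.2, if `F ≤ K(y)^h` for
  some `y ∈ F^h` transcendental over `K`, then `F ≤ K(y')^h` for some `y' ∈ F` transcendental
  over `K`.

## Content (everything PROVED; no definition, no named fact)

* `isGaloisStep_of_isNormalStep_of_forall_isSeparable` — a normal step of degree `p` inside a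
  separable extension is a Galois step.
* `exists_eq_henselization_of_isNormalPTower` — **the induction on the tower**: if
  `M = K(y)^h` with `y` transcendental, `T` is reached from `M` by normal steps of degree `p`,
  `T|M` is separable and `T` lies in an immediate extension `Φ` of `K` (here `Φ = F^h`), then,
  granted `(hstep)`, `T = K(y')^h` for some `y' ∈ T` transcendental over `K` (each step
  `K(yᵢ)^h ≤ Mᵢ₊₁` is Galois of degree `p`, so `Mᵢ₊₁ = K(yᵢ₊₁)^h` by `(hstep)`, with `yᵢ₊₁`
  again transcendental — `K(yᵢ₊₁)^h` contains `yᵢ` — and `K(yᵢ₊₁) ≤ Φ` immediate over `K`).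
* `Kuhlmann2019_Prop52_sepClosed.of_degreeP_steps` — **Prop. 5.2 from `(hstep)` and `(hKV)`**:
  `v` is non-trivial on `K` (rank one); in residue characteristic `0` the assertion is
  `kuhlmann2019_prop52_of_ringExpChar_eq_one`; otherwise a separating element `y ∈ F`
  (Lemma 5.4, `Kuhlmann2019_Lemma54_holds`) is transcendental over `K`, `E = F.K(y)^h` is a
  non-trivial-or-trivial finite separable extension of `K(y)^h` inside `F^h` (immediate over
  `K`: `Kuhlmann2010HenselizationImmediate_holds`, `henselization_mono`), Lemma 5.1
  (`isNormalPTower_henselization_of_isSepClosed`) makes it a tower of normal steps of degree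
  `p`, the induction gives `E = K(y₁)^h` with `y₁ ∈ E ⊆ F^h`, hence `F ≤ K(y₁)^h`, and `(hKV)`
  moves the generator into `F`.

## Sources

* [K19] F.-V. Kuhlmann, Israel J. Math. 234 (2019) = arXiv:1701.05508: Props. 4.8, 4.9
  (p. 11), Lemma 5.1, Prop. 5.2 (p. 12), Lemma 5.4 (p. 13). [Kuhlmann2019]
* [23] F.-V. Kuhlmann, I. Vlahu, *The relative approximation degree in valued function fields*,
  Math. Z. 276 (2014) 203–235: Thm. 11.1 (as quoted in [K19]; not held — acquisition requested).
* [KK09] H. Knaf, F.-V. Kuhlmann, Adv. Math. 221 (2009): Lemma 2.1. [KnafKuhlmann2009]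

## Rendering notes

As in `Kuhlmann2019HenselianRationalityFiniteRank.lean` and `Kuhlmann2019Prop52FirstSteps.lean`;
`IsGaloisStep p M T` (`NormalDegreePDefectless.lean`): `M ≤ T`, `[T : M] = p`, `T|M` Galois.
-/

noncomputable section

open IsLocalRing IntermediateField

namespace Literature.AlgebraicGeometry.Resolution

universe u

variable {Ω : Type u} [Field Ω] (V : ValuationSubring Ω)

/-! ### Normal steps inside separable extensions are Galois steps -/

omit V in
/-- A normal step `M ≤ M₁` of degree `p` all of whose elements are separable over `M` is a
Galois step. [folklore] -/
theorem isGaloisStep_of_isNormalStep_of_forall_isSeparable {p : ℕ} {M M₁ : Subfield Ω}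
    (h : IsNormalStep p M M₁) (hsep : ∀ z ∈ M₁, IsSeparable M z) : IsGaloisStep p M M₁ := by
  obtain ⟨hle, hdeg, hnorm⟩ := h
  haveI : Algebra.IsSeparable M (Subfield.extendScalars hle) :=
    ⟨fun z => by
      have hz := hsep (z : Ω) z.2
      unfold IsSeparable at hz ⊢
      rwa [IntermediateField.minpoly_eq]⟩
  exact ⟨hle, hdeg, isGalois_iff.mpr ⟨inferInstance, hnorm⟩⟩

/-! ### The induction on the tower of Galois extensions of degree `p` -/

section Induction

/-- **The induction in the proof of Prop. 5.2** ("By induction on the number of Galois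
extensions in the tower, using Proposition 4.8 or Proposition 4.9 respectively, we find
`y ∈ F^h` such that `F.K(x)^h = K(y)^h`"). Fix `K ≤ Ω`, a prime `p`, an immediate extension
`Φ` of `K` inside `(Ω, V)`, and assume the degree-`p` step `(hstep)` (Props. 4.8/4.9, see the
module docstring) for `K`. If `T` is reached from `M = K(y)^h`, `y` transcendental over `K`, by
a finite tower of normal extensions of degree `p`, `T ≤ Φ`, and every element of `T` is
separable over `M`, then `T = K(y')^h` for some `y' ∈ T` transcendental over `K`. PROVED by
induction on the tower: the first step is Galois (separability), `K(y) ≤ Φ` is immediate over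
`K`, so `(hstep)` rewrites it as `K(ϑ)^h`, `ϑ ∈ T`; `ϑ` is transcendental since `K(ϑ)^h ∋ y` is
algebraic over `K(ϑ)`; and the rest of the tower starts at `K(ϑ)^h`.
[cite: Kuhlmann2019, Prop. 5.2 (proof)] -/
theorem exists_eq_henselization_of_isNormalPTower {p : ℕ} {K : Subfield Ω}
    (hstep : ∀ (y : Ω) (E : Subfield Ω), Transcendental K y →
      IsImmediateOver V K (Subfield.closure ((K : Set Ω) ∪ {y})) →
      IsGaloisStep p (henselization V (Subfield.closure ((K : Set Ω) ∪ {y}))) E →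
      ∃ ϑ ∈ E, E = henselization V (Subfield.closure ((K : Set Ω) ∪ {ϑ})))
    {Φ : Subfield Ω} (himmΦ : IsImmediateOver V K Φ) {M T : Subfield Ω}
    (htower : IsNormalPTower p M T) :
    ∀ y : Ω, Transcendental K y → M = henselization V (Subfield.closure ((K : Set Ω) ∪ {y})) →
      T ≤ Φ → (∀ z ∈ T, IsSeparable M z) →
      ∃ y' ∈ T, Transcendental K y' ∧
        T = henselization V (Subfield.closure ((K : Set Ω) ∪ {y'})) := by
  induction htower with
  | refl M =>
    intro y hy hM _ _
    refine ⟨y, ?_, hy, hM⟩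
    rw [hM]
    exact le_henselization V _ (Subfield.subset_closure (Or.inr rfl))
  | @step M M₁ T hMM₁ hM₁T ih =>
    intro y hy hM hTΦ hsepT
    have hle : M ≤ M₁ := hMM₁.le
    have hle₁ : M₁ ≤ T := hM₁T.le
    -- the first step is Galois
    have hgal : IsGaloisStep p M M₁ :=
      isGaloisStep_of_isNormalStep_of_forall_isSeparable hMM₁ fun z hz => hsepT z (hle₁ hz)
    -- `K(y) ≤ M ≤ M₁ ≤ T ≤ Φ` is immediate over `K`
    have hKyM : Subfield.closure ((K : Set Ω) ∪ {y}) ≤ M := hM ▸ le_henselization V _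
    have himmy : IsImmediateOver V K (Subfield.closure ((K : Set Ω) ∪ {y})) :=
      himmΦ.mono_right (hKyM.trans (hle.trans (hle₁.trans hTΦ)))
    rw [hM] at hgal
    obtain ⟨ϑ, hϑM₁, hM₁⟩ := hstep y M₁ hy himmy hgal
    -- `ϑ` is transcendental over `K`: `y ∈ K(ϑ)^h` is algebraic over `K(ϑ)`
    have hϑ : Transcendental K ϑ := by
      intro hϑalg
      apply hy
      have hyM₁ : y ∈ henselization V (Subfield.closure ((K : Set Ω) ∪ {ϑ})) :=
        hM₁ ▸ hle (hKyM (Subfield.subset_closure (Or.inr rfl)))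
      have h1 : IsAlgebraic (Subfield.closure ((K : Set Ω) ∪ {ϑ})) y :=
        (isSeparable_of_mem_henselization V _ hyM₁).isIntegral.isAlgebraic
      refine isAlgebraic_trans_subfield (K := K) (fun c hc => Subfield.subset_closure (Or.inl hc))
        (fun w hw => isAlgebraic_of_mem_closure (fun x hx => ?_) hw) h1
      rw [Set.mem_singleton_iff.mp hx]
      exact hϑalg
    have hsepM₁ : ∀ z ∈ T, IsSeparable M₁ z := fun z hz => isSeparable_of_subfield_le hle (hsepT z hz)
    exact ih ϑ hϑ hM₁ hTΦ hsepM₁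

end Induction

/-! ### Prop. 5.2 from the degree-`p` step and [23, Thm. 11.1] -/

/-- **Kuhlmann 2019, Prop. 5.2, from Props. 4.8/4.9 and [23, Thm. 11.1].** The named fact
`Kuhlmann2019_Prop52_sepClosed` ("Every immediate separable function field `(F|K,v)` of
transcendence degree 1 over a separable-algebraically closed field `(K,v)` of rank 1 is
henselian rational") follows from the two hypotheses `(hstep)` = Props. 4.8/4.9 for
separable-algebraically closed `K` of rank one and `(hKV)` = [23, Thm. 11.1] as applied in the
printed proof (see the module docstring for both), everything else in the printed proof being
PROVED: non-triviality of `v` on `K` (rank one), the residue-characteristic-`0` case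
(`kuhlmann2019_prop52_of_ringExpChar_eq_one`), the separating element (Lemma 5.4,
`Kuhlmann2019_Lemma54_holds`) and its transcendence, finiteness and separability of
`E = F.K(y)^h` over `K(y)^h` and `E ≤ F^h` immediate over `K`
(`Kuhlmann2010HenselizationImmediate_holds`, `henselization_mono`), Lemma 5.1
(`isNormalPTower_henselization_of_isSepClosed`), and the induction on the tower
(`exists_eq_henselization_of_isNormalPTower`). [cite: Kuhlmann2019, Prop. 5.2] -/
theorem Kuhlmann2019_Prop52_sepClosed.of_degreeP_steps
    (hstep : ∀ (Ω : Type u) [Field Ω] [IsAlgClosed Ω] (V : ValuationSubring Ω) (p : ℕ)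
      [CharP (ResidueField V) p], p.Prime → ∀ (K : Subfield Ω) (y : Ω) (E : Subfield Ω),
      IsSepClosed K → IsRankOne V K → Transcendental K y →
      IsImmediateOver V K (Subfield.closure ((K : Set Ω) ∪ {y})) →
      IsGaloisStep p (henselization V (Subfield.closure ((K : Set Ω) ∪ {y}))) E →
      ∃ ϑ ∈ E, E = henselization V (Subfield.closure ((K : Set Ω) ∪ {ϑ})))
    (hKV : ∀ (Ω : Type u) [Field Ω] [IsAlgClosed Ω] (V : ValuationSubring Ω)
      (K F : Subfield Ω) (y : Ω), IsSepClosed K → IsRankOne V K → K ≤ F → FGOver K F →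
      SeparablyGeneratedOver K F →
      (∃ x ∈ F, Transcendental K x ∧
        ∀ z ∈ F, IsAlgebraic (IntermediateField.adjoin K ({x} : Set Ω)) z) →
      IsImmediateOver V K F → y ∈ henselization V F → Transcendental K y →
      F ≤ henselization V (Subfield.closure ((K : Set Ω) ∪ {y})) →
      ∃ y' ∈ F, Transcendental K y' ∧
        F ≤ henselization V (Subfield.closure ((K : Set Ω) ∪ {y'}))) :
    Kuhlmann2019_Prop52_sepClosed.{u} := by
  intro Ω _ _ V K F hK hr hKF hfg hsg h1 himm
  classical
  haveI : IsSepClosed K := hK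
  -- `v` is non-trivial on `K` (rank one)
  have hnt : ∃ a ∈ K, a ∉ V := by
    by_contra hall
    push Not at hall
    apply hr.1
    ext c
    simp only [ValuationSubring.mem_comap, ValuationSubring.mem_top, iff_true]
    exact hall c c.2
  -- the residue characteristic
  obtain ⟨p, hcharp⟩ := CharP.exists (ResidueField V)
  by_cases hp0 : p = 0
  · subst hp0
    haveI : CharZero (ResidueField V) := CharP.charP_to_charZero (ResidueField V)
    exact kuhlmann2019_prop52_of_ringExpChar_eq_one V K F hKF h1 himm
      (ringExpChar.eq (ResidueField V) 1)
  have hp : p.Prime := CharP.char_prime_of_ne_zero (ResidueField V) hp0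
  haveI : Fact p.Prime := ⟨hp⟩
  obtain ⟨t, htF, ht, halg⟩ := h1
  -- a separating element `y ∈ F` (Lemma 5.4); it is transcendental over `K`
  have hntF : ∃ a ∈ F, a ≠ 0 ∧ V.valuation a ≠ 1 := by
    obtain ⟨a, haK, haV⟩ := hnt
    refine ⟨a, hKF haK, fun h0 => haV (h0 ▸ V.zero_mem), fun h1 => haV ?_⟩
    exact (V.valuation_le_one_iff a).mp h1.le
  have ht0 : t ≠ 0 := fun h0 => ht (h0 ▸ isAlgebraic_zero)
  obtain ⟨y, hyF, hysep, -, -⟩ :=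
    Kuhlmann2019_Lemma54_holds Ω V K F hKF hfg hsg ⟨t, htF, ht, halg⟩ hntF t htF ht0
  have hy : Transcendental K y := by
    intro hyalg
    apply ht
    haveI : FiniteDimensional K (IntermediateField.adjoin K ({y} : Set Ω)) :=
      IntermediateField.adjoin.finiteDimensional hyalg.isIntegral
    haveI : Algebra.IsIntegral K (IntermediateField.adjoin K ({y} : Set Ω)) :=
      Algebra.IsIntegral.of_finite K _
    exact (isIntegral_trans (R := K) (A := IntermediateField.adjoin K ({y} : Set Ω)) t
      (hysep t htF).isIntegral).isAlgebraic
  -- `K(y)`, its henselization `L = K(y)^h`, `F^h`, and `E = F.L`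
  set Ky : Subfield Ω := Subfield.closure ((K : Set Ω) ∪ {y}) with hKydef
  set L : Subfield Ω := henselization V Ky with hLdef
  have hKKy : K ≤ Ky := fun c hc => Subfield.subset_closure (Or.inl hc)
  have hKyF : Ky ≤ F :=
    Subfield.closure_le.mpr (Set.union_subset hKF (Set.singleton_subset_iff.mpr hyF))
  have hKyL : Ky ≤ L := le_henselization V Ky
  have himmKy : IsImmediateOver V K Ky := himm.mono_right hKyF
  set Fh : Subfield Ω := henselization V F with hFhdef
  have himmFh : IsImmediateOver V K Fh :=
    himm.trans (Kuhlmann2010HenselizationImmediate_holds Ω V F)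
  have hLFh : L ≤ Fh := henselization_mono V Kuhlmann2010HenselizationIsHenselian_holds hKyF
  have hFFh : F ≤ Fh := le_henselization V F
  obtain ⟨s, hs⟩ := hfg
  set E : Subfield Ω := Subfield.closure ((L : Set Ω) ∪ s) with hEdef
  have hsF : (s : Set Ω) ⊆ F := fun a ha => hs ▸ Subfield.subset_closure (Or.inr ha)
  have hLE : L ≤ E := fun c hc => Subfield.subset_closure (Or.inl hc)
  have hFE : F ≤ E := by
    rw [← hs]
    exact Subfield.closure_mono (Set.union_subset_union_left _ (hKKy.trans hKyL))
  have hEFh : E ≤ Fh := Subfield.closure_le.mpr (Set.union_subset hLFh (hsF.trans hFFh))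
  -- `E|L` is finite and separable
  have hsepL : ∀ a ∈ (s : Set Ω), IsSeparable L a := fun a ha =>
    isSeparable_of_subfield_le hKyL ((isSeparable_closure_iff K {y} a).mpr (hysep a (hsF ha)))
  have hsepE : ∀ z ∈ E, IsSeparable L z := fun z hz => isSeparable_of_mem_closure hsepL hz
  have hpos : 0 < Subfield.relfinrank L E :=
    relfinrank_closure_pos L s fun a ha => (hsepL a (Finset.mem_coe.mpr ha)).isIntegral
  -- Lemma 5.1: `E` is reached from `L` by normal steps of degree `p`
  have htower : IsNormalPTower p L E :=
    isNormalPTower_henselization_of_isSepClosed V hp K hnt hKKy himmKy hLE hpos hsepE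
  -- the induction along the tower: `E = K(y₁)^h`, `y₁ ∈ E ⊆ F^h`
  obtain ⟨y₁, hy₁E, hy₁, hE⟩ := exists_eq_henselization_of_isNormalPTower V
    (fun y' E' hy' himm' hgal' => hstep Ω V p hp K y' E' hK hr hy' himm' hgal') himmFh htower
    y hy rfl hEFh hsepE
  -- [23, Thm. 11.1]: the generator can be taken in `F`
  have hFle : F ≤ henselization V (Subfield.closure ((K : Set Ω) ∪ {y₁})) := hE ▸ hFE
  exact hKV Ω V K F y₁ hK hr hKF ⟨s, hs⟩ hsg ⟨t, htF, ht, halg⟩ himm (hEFh hy₁E) hy₁ hFle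

end Literature.AlgebraicGeometry.Resolution

end
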